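import Summits.PneNP.GCT.Max.DetKYLeadingTerms
import Summits.PneNP.GCT.Max.SF6PermanentSide
import Summits.PneNP.GCT.Conjectures.KYFlatteningBlindPaddedPerThree
import HarnessLib
import HarnessLib.Audit

/-!
# `GCT/Max`: N-F-1 for `n ≥ 5` — plain Koszul–Young flattenings do not separate the padded `3 × 3` permanent from `det_n`
# (the located negative C-F-3′ at `m = 3`), PROVED; and the edge "`n = 4` slice ⇒ `KYCannotSeparatePaddedPerThree`"

Cell `pub-gct-max` (HOME `run/shared/lean/pub/pub-gct-max/`), track F, Lean port S-F-6 (lead D53 (1), D65 (a); statements file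
`S-F-6-STATEMENTS.md` sha256/16 `c9b9751c94d03f25`; referee read 2026-08-23T04:57:52Z: "no objection", remarks R1–R4), assembled by
lit-2 from: theory-2's kernel-checked skeleton `lean-scratch/SF6Assembly.lean` (`070a324692f9b2dc`: the 684 stage-3 cell inequalities
by plain kernel `decide`, the case analysis) — re-homed here — and the modules `Max/SF6Arithmetic.lean` (stage 2 + smoothing),
`Max/SF6PermanentSide.lean` (padded-`per₃` side), `Max/DetKYLeadingTermsFamily.lean` + `Max/DetKYLeadingTerms.lean` (the leading-term
lower bound `max(LT, LT^dual) ≤ rank KY_{p,k}(det_n)`, lit-2). Mathematics: theory-2, memo `CF3-THEOREM.md` (v1.1 `9ea98dd57dfc3673`,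
referee-read PASS 2026-08-23T04:18Z; NOT IN PRINT — lit-2 D61 / lit-1 D70). HONEST FRAMING: multiplicity data and certified rank bounds
at small parameters; a LOCATED NEGATIVE about ONE family of equations (Koszul–Young flattenings `Λ^p ⊗ S^k`) for the padded `3 × 3`
permanent — not a statement about other Young flattenings, border apolarity or multiplicity obstructions; occurrence obstructions are
ruled out in print (BIP'16) — multiplicity obstructions are the open door; nothing here is a claim on VP vs VNP or P vs NP.

**What is proved (`KYCannotSeparatePaddedPerThreeFromFive`, `kyCannotSeparatePaddedPerThreeFromFive_holds`).** For every `n ≥ 5`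
and every `(p, k)`: `rank KY_{p,k}(X₀₀^{n-3}·per₃) ≤ rank KY_{p,k}(det_n)` in `S^n(ℂ^{n²})` — i.e. the `n ≥ 5` slice of the node
`KYCannotSeparatePaddedPerThree` (N-F-1, `Conjectures/KYFlatteningBlindPaddedPerThree.lean`). Chain per cell (`N = n²`; trivial
ranges `k ≥ n`, `p ≥ N` give `0` on the left — referee R2): permanent side `rank ≤ boundS N p k = min(Ssum k·C(N,p), Ssum(k+1)·C(N,p+1))`
at the primal cell `k ≤ (n-1)/2`, and the high-order form (= `boundS` at the dual cell `(N-1-p, n-1-k)`) otherwise; determinant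
side `max(LT(n,N-1-p,k), LT(n,p,n-1-k)) ≤ rank KY_{p,k}(det_n)` (leading terms + transpose duality, referee R4's `k+1 ≤ n` kept);
in between, for `n = 5, 6, 7` the 684 decidable inequalities `cellBound n p k ≤ cellMax n p k` (theory-2: `U⁺ ≤ max(LT, LT^dual)` holds at every
cell, so NO cone law is needed — stage 3), and for `n ≥ 8` the per-`k` criterion + smoothing `boundS ≤ LT` (`SF6StageTwoCellBound`,
stage 2; sharp: the criterion fails at `n = 7`, `k = 1`).

**What is NOT proved here: `n = 4`.** At `n = 4` the cell inequality FAILS (18 of 64 cells, e.g. `¬ (cellBoundD 4 3 2 ≤ cellMaxD 4 3 2)`,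
kernel-checked below); the node's `n = 4` slice rests on engine-3's exact-rank certificates (`HOME/flat/NF1-CERTS-n4`, 64 cells) which are not in Lean.
Per referee R1 the node is SPLIT: the `n = 4` slice is typed here as the obligation node `KYCannotSeparatePaddedPerThreeAtFour`
(`@[conjecture]`: a cell statement certified outside Lean, not a published theorem), and the edge
`AtFourImpliesCannotSeparate : KYCannotSeparatePaddedPerThreeAtFour → KYCannotSeparatePaddedPerThree` is PROVED
(`atFourImpliesCannotSeparate_holds`; shape α of the lead's ruling 2026-08-23T03:07:14Z: implications between nodes are untagged
`Prop`s with a `_holds` proof, so no theorem's conclusion is a conjecture node).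

## References (statements as printed: `HOME/typed/AS-PRINTED-2.md` §F; `HOME/typed/CHAIN-2.md` §4)
* [LandsbergGCT2017] §8.2.1 eq. (8.2.1), Prop. 8.2.1.1.  * [EfremenkoLandsbergSchenckWeyman2018] §1.1, Rem. 1.3–1.4, the sentence
  after Thm. 1.5 (the possibility these located negatives speak to).  * [Farnsworth2016] Thm. 1.6 / 1.8.
-/

noncomputable section

namespace Summit.PneNP.GCT

open Literature.Computability.AlgebraicComplexity Literature.Barriers.ValiantsHypothesis

/-! ## Stage 3 (n = 5, 6, 7): the 684 cell inequalities by kernel `decide`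
(binomials evaluated through `descFactorial / factorial`, which the kernel computes with GMP arithmetic). -/

namespace SF6Stage3

open Finset

/-- The padded-side bound of the cell `(p,k)`: `boundS n² p k` at a primal cell `k ≤ (n-1)/2`, and `boundS` at the dual cell
`(n²-1-p, n-1-k)` otherwise (a natural number). [folklore] -/
def cellBound (n p k : ℕ) : ℕ :=
  if k ≤ (n - 1) / 2 then boundS (n * n) p k else boundS (n * n) (n * n - 1 - p) (n - 1 - k)

/-- The determinant-side count of the cell `(p,k)`: the larger of the two leading-term counts of `det_n`
(`LT` at the cell, target exponent `c = n²-1-p`, and `LT` at the dual cell, target exponent `c = p`). [folklore] -/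
def cellMax (n p k : ℕ) : ℕ :=
  max (DetKYLeadingTerms.ltCount n (n * n - 1 - p) k) (DetKYLeadingTerms.ltCount n p (n - 1 - k))

/-- Kernel-friendly binomial (`descFactorial / factorial`, computed by the kernel with GMP arithmetic). [folklore] -/
def chooseD (a b : ℕ) : ℕ := a.descFactorial b / b.factorial

/-- `chooseD = Nat.choose` (`Nat.choose_eq_descFactorial_div_factorial`). [folklore] -/
lemma chooseD_eq (a b : ℕ) : chooseD a b = a.choose b :=
  (Nat.choose_eq_descFactorial_div_factorial a b).symm

/-- Kernel-friendly mirror of `ltCount`. [folklore] -/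
def LTD (n c k : ℕ) : ℕ :=
  ∑ i : Fin n, ∑ j : Fin n, chooseD i k * chooseD j k * chooseD ((i : ℕ) * n + j) c

/-- `LTD = ltCount`. [folklore] -/
lemma LTD_eq (n c k : ℕ) : LTD n c k = DetKYLeadingTerms.ltCount n c k := by
  simp [LTD, DetKYLeadingTerms.ltCount, chooseD_eq]

/-- Kernel-friendly mirror of `Ssum`. [folklore] -/
def SsumD (k : ℕ) : ℕ := ∑ j ∈ range (k + 1), (chooseD 3 j) ^ 2

/-- `SsumD = Ssum`. [folklore] -/
lemma SsumD_eq (k : ℕ) : SsumD k = Ssum k := by simp [SsumD, Ssum, chooseD_eq]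

/-- Kernel-friendly mirror of `boundS`. [folklore] -/
def boundSD (N p k : ℕ) : ℕ := min (SsumD k * chooseD N p) (SsumD (k + 1) * chooseD N (p + 1))

/-- `boundSD = boundS`. [folklore] -/
lemma boundSD_eq (N p k : ℕ) : boundSD N p k = boundS N p k := by
  simp [boundSD, boundS, SsumD_eq, chooseD_eq]

/-- Kernel-friendly mirror of `cellBound`. [folklore] -/
def cellBoundD (n p k : ℕ) : ℕ :=
  if k ≤ (n - 1) / 2 then boundSD (n * n) p k else boundSD (n * n) (n * n - 1 - p) (n - 1 - k)

/-- `cellBoundD = cellBound`. [folklore] -/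
lemma cellBoundD_eq (n p k : ℕ) : cellBoundD n p k = cellBound n p k := by
  simp only [cellBoundD, cellBound, boundSD_eq]

/-- Kernel-friendly mirror of `cellMax`. [folklore] -/
def cellMaxD (n p k : ℕ) : ℕ := max (LTD n (n * n - 1 - p) k) (LTD n p (n - 1 - k))

/-- `cellMaxD = cellMax`. [folklore] -/
lemma cellMaxD_eq (n p k : ℕ) : cellMaxD n p k = cellMax n p k := by
  simp only [cellMaxD, cellMax, LTD_eq]

/-- The 125 cells of `n = 5`, kernel `decide` on the mirrors. [folklore] -/
theorem stage3_n5D : ∀ p < 25, ∀ k < 5, cellBoundD 5 p k ≤ cellMaxD 5 p k := by decide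

/-- **Stage 3, `n = 5`**: `cellBound 5 p k ≤ cellMax 5 p k` for all `p < 25`, `k < 5`. [folklore] -/
theorem stage3_n5 (p k : ℕ) (hp : p < 25) (hk : k < 5) : cellBound 5 p k ≤ cellMax 5 p k := by
  rw [← cellBoundD_eq, ← cellMaxD_eq]; exact stage3_n5D p hp k hk

/-- The 216 cells of `n = 6`, kernel `decide` on the mirrors. [folklore] -/
theorem stage3_n6D : ∀ p < 36, ∀ k < 6, cellBoundD 6 p k ≤ cellMaxD 6 p k := by decide

/-- **Stage 3, `n = 6`**: `cellBound 6 p k ≤ cellMax 6 p k` for all `p < 36`, `k < 6`. [folklore] -/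
theorem stage3_n6 (p k : ℕ) (hp : p < 36) (hk : k < 6) : cellBound 6 p k ≤ cellMax 6 p k := by
  rw [← cellBoundD_eq, ← cellMaxD_eq]; exact stage3_n6D p hp k hk

/-- The 343 cells of `n = 7`, kernel `decide` on the mirrors. [folklore] -/
theorem stage3_n7D : ∀ p < 49, ∀ k < 7, cellBoundD 7 p k ≤ cellMaxD 7 p k := by decide

/-- **Stage 3, `n = 7`**: `cellBound 7 p k ≤ cellMax 7 p k` for all `p < 49`, `k < 7`. [folklore] -/
theorem stage3_n7 (p k : ℕ) (hp : p < 49) (hk : k < 7) : cellBound 7 p k ≤ cellMax 7 p k := by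
  rw [← cellBoundD_eq, ← cellMaxD_eq]; exact stage3_n7D p hp k hk

/- `n = 4` is genuinely different: the cell inequality FAILS there (18 of 64 cells), e.g. at `(p,k) = (3,2)`; the node's
`n = 4` slice rests on engine-3's exact-rank certificates instead (FLAT-PLAN NF1-CERTS-n4) — see
`KYCannotSeparatePaddedPerThreeAtFour` below. Kernel-checked as an unnamed `example`. -/
example : ¬ (cellBoundD 4 3 2 ≤ cellMaxD 4 3 2) := by decide

end SF6Stage3

/-! ## Glue: `Ssum = S3` and the primal stage-2 chain `boundS ≤ LT` (`n ≥ 8`) -/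

namespace SF6Assembly

/-- `Ssum (k+1) = Ssum k + C(3,k+1)²`. [folklore] -/
lemma Ssum_succ (k : ℕ) : SF6Stage3.Ssum (k + 1) = SF6Stage3.Ssum k + (Nat.choose 3 (k + 1)) ^ 2 := by
  unfold SF6Stage3.Ssum
  rw [Finset.sum_range_succ]

/-- `Ssum k = 20` for `k ≥ 3`. [folklore] -/
lemma Ssum_of_three_le (k : ℕ) (hk : 3 ≤ k) : SF6Stage3.Ssum k = 20 := by
  induction k, hk using Nat.le_induction with
  | base => decide
  | succ j hj ih => rw [Ssum_succ, ih, Nat.choose_eq_zero_of_lt (by omega)]; simp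

/-- The tree-form sum `Ssum` equals theory-2's truncation-safe `S3`. [folklore] -/
lemma Ssum_eq_S3 (k : ℕ) : SF6Stage3.Ssum k = SF6Stage2.S3 k := by
  rcases Nat.lt_or_ge k 3 with h | h
  · interval_cases k <;> decide
  · rw [Ssum_of_three_le k h, SF6Stage2.S3_of_three_le k h]

/-- The primal chain for `n ≥ 8`, `k ≤ (n-1)/2`, `p+1 ≤ n²`: `boundS ≤ LT` (stage 2 + smoothing). [folklore] -/
lemma boundS_le_ltCount (n p k : ℕ) (hn : 8 ≤ n) (hk : k ≤ (n - 1) / 2) (hp : p + 1 ≤ n * n) :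
    SF6Stage3.boundS (n * n) p k ≤ DetKYLeadingTerms.ltCount n (n * n - 1 - p) k := by
  unfold SF6Stage3.boundS
  refine (min_le_left _ _).trans ?_
  rw [Ssum_eq_S3]
  exact sF6StageTwoCellBound_holds n p k hn hk hp

/-- **N-F-1 at `m = 3` for every `n ≥ 5` and every cell `(p, k)`** — the assembly (theory-2's case analysis with the three
inputs now theorems of the tree: `detKYLeadingTermBound_holds`, `paddedPerThreeKYUpperBounds_holds`, stages 2/3). [folklore] -/
theorem kyRank_paddedPerPoly_three_le_detPoly (n : ℕ) [NeZero n] (hn5 : 5 ≤ n) (p k : ℕ) :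
    kyRank ℂ p k (paddedPerPoly ℂ 3 n) ≤ kyRank ℂ p k (detPoly (Fin n) ℂ) := by
  obtain ⟨hb, hbh, hz⟩ := paddedPerThreeKYUpperBounds_holds n p k (by omega)
  rcases Nat.lt_or_ge k n with hk | hk
  swap
  · rw [hz hk]; exact Nat.zero_le _
  rcases Nat.lt_or_ge p (n * n) with hp | hp
  swap
  · have h0 : SF6Stage3.boundS (n * n) p k = 0 := by
      unfold SF6Stage3.boundS
      rw [Nat.choose_eq_zero_of_lt (by omega : n * n < p + 1)]
      simp
    rw [h0] at hb
    exact hb.trans (Nat.zero_le _)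
  have hpN : p + 1 ≤ n * n := hp
  have hkn : k + 1 ≤ n := hk
  -- determinant side: both leading-term counts are below rank KY_{p,k}(det_n)
  have hdetmax : SF6Stage3.cellMax n p k ≤ kyRank ℂ p k (detPoly (Fin n) ℂ) :=
    detKYLeadingTermBound_holds n p k hpN hkn
  have hdet1 : DetKYLeadingTerms.ltCount n (n * n - 1 - p) k ≤ kyRank ℂ p k (detPoly (Fin n) ℂ) :=
    (le_max_left _ _).trans hdetmax
  have hdet2 : DetKYLeadingTerms.ltCount n p (n - 1 - k) ≤ kyRank ℂ p k (detPoly (Fin n) ℂ) :=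
    (le_max_right _ _).trans hdetmax
  -- padded side: the bound at the primal or the dual cell
  have hpad : kyRank ℂ p k (paddedPerPoly ℂ 3 n) ≤ SF6Stage3.cellBound n p k := by
    unfold SF6Stage3.cellBound
    split_ifs with hks
    · exact hb
    · have h := hbh
      rw [show n - (k + 1) = n - 1 - k by omega] at h
      unfold SF6Stage3.boundS
      rw [show n * n - 1 - p = n * n - (p + 1) by omega, Nat.choose_symm (show p + 1 ≤ n * n by omega),
        show n * n - (p + 1) + 1 = n * n - p by omega, Nat.choose_symm (show p ≤ n * n by omega),
        show n - 1 - k + 1 = n - k by omega, min_comm]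
      exact h
  -- n = 5, 6, 7 by the stage-3 cells; n ≥ 8 by stage 2 + smoothing
  rcases (by omega : n = 5 ∨ n = 6 ∨ n = 7 ∨ 8 ≤ n) with h5 | h6 | h7 | h8
  · subst h5
    exact hpad.trans ((SF6Stage3.stage3_n5 p k (by omega) (by omega)).trans hdetmax)
  · subst h6
    exact hpad.trans ((SF6Stage3.stage3_n6 p k (by omega) (by omega)).trans hdetmax)
  · subst h7
    exact hpad.trans ((SF6Stage3.stage3_n7 p k (by omega) (by omega)).trans hdetmax)
  · unfold SF6Stage3.cellBound at hpad
    by_cases hks : k ≤ (n - 1) / 2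
    · rw [if_pos hks] at hpad
      exact hpad.trans ((boundS_le_ltCount n p k h8 hks hpN).trans hdet1)
    · rw [if_neg hks] at hpad
      have hchain := boundS_le_ltCount n (n * n - 1 - p) (n - 1 - k) h8 (by omega) (by omega)
      rw [show n * n - 1 - (n * n - 1 - p) = p by omega] at hchain
      exact hpad.trans (hchain.trans hdet2)

end SF6Assembly

/-! ## The nodes and the edge -/

/-- **N-F-1 for `n ≥ 5`** (the `n ≥ 5` slice of `KYCannotSeparatePaddedPerThree`): for every `n ≥ 5` and every `(p, k)`,
`rank KY_{p,k}(X₀₀^{n-3}·per₃) ≤ rank KY_{p,k}(det_n)` in `S^n(ℂ^{n²})` — no plain Koszul–Young flattening `Λ^p ⊗ S^k` has larger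
rank on the padded `3 × 3` permanent than on `det_n`, so none certifies `X₀₀^{n-3}per₃ ∉ \overline{GL_{n²}·det_n}` (a containment
that is FALSE for `n = 5, 6` in print: `dc(per₃) = 7`, Alper–Bogart–Velasco 2017). A statement of the cell (C-F-3′ at `m = 3`,
theory-2 CF3-THEOREM; not in print), PROVED below as `kyCannotSeparatePaddedPerThreeFromFive_holds`. [folklore] -/
def KYCannotSeparatePaddedPerThreeFromFive : Prop :=
  ∀ (n : ℕ) [NeZero n], 5 ≤ n → ∀ p k : ℕ,
    kyRank ℂ p k (paddedPerPoly ℂ 3 n) ≤ kyRank ℂ p k (detPoly (Fin n) ℂ)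

/-- **N-F-1 holds for every `n ≥ 5`** (stage 2 for `n ≥ 8`, stage 3 for `n = 5, 6, 7`). [folklore] -/
theorem kyCannotSeparatePaddedPerThreeFromFive_holds : KYCannotSeparatePaddedPerThreeFromFive :=
  fun n _ hn p k => SF6Assembly.kyRank_paddedPerPoly_three_le_detPoly n hn p k

/-- **The `n = 4` slice of N-F-1 (referee R1: certificate-based, split off as its own node):** for every `(p, k)`,
`rank KY_{p,k}(X₀₀·per₃) ≤ rank KY_{p,k}(det₄)` in `S⁴(ℂ¹⁶)` (64 cells). CERTIFIED by the cell outside Lean (engine-3 exact-rank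
certificates `HOME/flat/NF1-CERTS-n4`: P1/P2 HIT on all 64 cells, job j175878) but NOT provable by the cell inequality of this
file (it fails at 18 of the 64 cells, e.g. `(p,k) = (3,2)`, see the `example` in section `SF6Stage3`); an obligation node until the certificates
are replayed in Lean. CONJECTURE/evidence statement of the cell, NOT a published theorem. [folklore] -/
@[conjecture]
def KYCannotSeparatePaddedPerThreeAtFour : Prop :=
  ∀ p k : ℕ, kyRank ℂ p k (paddedPerPoly ℂ 3 4) ≤ kyRank ℂ p k (detPoly (Fin 4) ℂ)

/-- The implication **(`n = 4` slice) ⇒ N-F-1 for all `n ≥ 4`** as a named statement (shape α). [folklore] -/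
def AtFourImpliesCannotSeparate : Prop := KYCannotSeparatePaddedPerThreeAtFour → KYCannotSeparatePaddedPerThree

/-- **(`n = 4` slice) ⇒ N-F-1 holds**: `n = 4` is the hypothesis, every `n ≥ 5` is
`kyCannotSeparatePaddedPerThreeFromFive_holds`. [folklore] -/
theorem atFourImpliesCannotSeparate_holds : AtFourImpliesCannotSeparate := by
  intro h4 n _ hn p k
  by_cases h : n = 4
  · subst h
    exact h4 p k
  · exact kyCannotSeparatePaddedPerThreeFromFive_holds n (by omega) p k

end Summit.PneNP.GCT
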